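import Mathlib
import Summits.ValiantsHypothesis.ValiantsHypothesis.Theorems.BarrierLeverPartitionMinorsHitByVPHiddenStatesFullJoinGeneric

/-!
# Route BarrierLever — item `PartitionMinorsHitByVP` (stmt-ValiantsHypothesis-19717), line `hidden_states`:
# THE EQUAL-LINK STEP WITHOUT BOOKKEEPING — the split data (`eRow`, `eCol`, `π`) constructed from the families themselves

Helper file (`--supports stmt-ValiantsHypothesis-19717`; cell valiant-natproofs, rung V4, 𝒟-side door (c), line
`Cruxes/PartitionMinorsHitByVP/Lines/hidden_states.lean` v8; prover seat val-np-p3 gen 16). Definition-free. Closes NO item.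

THE POINT (memo val-np-p3 g16 «full join» §9). `fullJoinCube_step'` (p675575) asks the user for explicit equivalences `Fin rD ⊕ Fin rL ≃ Fin r`
splitting the rows of `u` at `a` and the columns of `w` at `b`, and for the deletion-partner map `π`. THIS FILE constructs them: given a LOWER
family `u` (so that `U ∖ a` stays in the family), ANY injective enumerations `uD`, `uL`, `wD`, `wL` of the deletion families
`{U ∈ u : a ∉ U}`, `{W ∈ w : b ∉ W}` and of the link families `{U ∖ a : a ∈ U ∈ u}`, `{W ∖ b : b ∈ W ∈ w}` (given by their RANGES) with
matching sizes `rD`, `rL`, and FJ for `(uD, wD)` and for `(uL, wL)` with `K` states, conclude FJ for `(u, w)` with `K + 1` states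
(`fullJoinCube_step_of_ranges`). The equivalences come from `Equiv.ofBijective` on the index correspondences and `Equiv.sumCompl`; `π` from
the lower-set property. With the star leaf (p675793) and the diagonal/isomorphic base (p673836/p674147) this is the user-facing form of the
PEEL⁺ induction: a peeling is now just a list of (coordinate, coordinate) choices with equal link sizes plus range bookkeeping by `decide`/`simp`.

WHAT THIS IS NOT: no pair is certified here beyond the hypotheses; item 19717 stays OPEN; nothing on crux 14610 or VP ≠ VNP.
-/

set_option linter.dupNamespace false

namespace Summit.ValiantsHypothesis.ValiantsHypothesis.Theorems.BarrierLever.HiddenStates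

open Finset Matrix

noncomputable section

namespace FullJoin

variable {h r rD rL : ℕ}

/-- **Index equivalence for the deletion part.** If `uD` enumerates injectively exactly the members of `u` avoiding `a`, there is an
equivalence `Fin rD ≃ {i // a ∉ u i}` transporting `uD` to `u`. -/
theorem exists_equiv_deletion (u : Fin r → Finset (Fin h)) (hu : Function.Injective u) (a : Fin h)
    (uD : Fin rD → Finset (Fin h)) (huD : Function.Injective uD)
    (hrD : Set.range uD = {U | U ∈ Set.range u ∧ a ∉ U}) :
    ∃ eD : Fin rD ≃ {i : Fin r // a ∉ u i}, ∀ k, u (eD k).1 = uD k := by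
  classical
  have hex : ∀ k : Fin rD, ∃ i : Fin r, a ∉ u i ∧ u i = uD k := by
    intro k
    have hk : uD k ∈ {U | U ∈ Set.range u ∧ a ∉ U} := hrD ▸ Set.mem_range_self k
    obtain ⟨⟨i, hi⟩, hnot⟩ := hk
    exact ⟨i, hi ▸ hnot, hi⟩
  choose f hfa hfu using hex
  let g : Fin rD → {i : Fin r // a ∉ u i} := fun k => ⟨f k, hfa k⟩
  have hg : Function.Bijective g := by
    constructor
    · intro k k' hkk'
      have : f k = f k' := congrArg Subtype.val hkk'
      apply huD
      rw [← hfu k, ← hfu k', this]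
    · rintro ⟨i, hi⟩
      have hmem : u i ∈ Set.range uD := by
        rw [hrD]; exact ⟨Set.mem_range_self i, hi⟩
      obtain ⟨k, hk⟩ := hmem
      refine ⟨k, Subtype.ext ?_⟩
      exact hu (by rw [hfu k, hk])
  exact ⟨Equiv.ofBijective g hg, fun k => hfu k⟩

/-- **Index equivalence for the link part.** If `uL` enumerates injectively exactly the sets `U ∖ a` over the members `U ∋ a` of `u`, there
is an equivalence `Fin rL ≃ {i // ¬ a ∉ u i}` with `u (eL ℓ) ∖ a = uL ℓ`. -/
theorem exists_equiv_link (u : Fin r → Finset (Fin h)) (hu : Function.Injective u) (a : Fin h)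
    (uL : Fin rL → Finset (Fin h)) (huL : Function.Injective uL)
    (hrL : Set.range uL = (fun U => U.erase a) '' {U | U ∈ Set.range u ∧ a ∈ U}) :
    ∃ eL : Fin rL ≃ {i : Fin r // ¬ a ∉ u i}, ∀ ℓ, (u (eL ℓ).1).erase a = uL ℓ := by
  classical
  have hex : ∀ ℓ : Fin rL, ∃ i : Fin r, a ∈ u i ∧ (u i).erase a = uL ℓ := by
    intro ℓ
    have hℓ : uL ℓ ∈ (fun U => U.erase a) '' {U | U ∈ Set.range u ∧ a ∈ U} := hrL ▸ Set.mem_range_self ℓ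
    obtain ⟨U, ⟨⟨i, hi⟩, haU⟩, hU⟩ := hℓ
    exact ⟨i, hi ▸ haU, by rw [hi]; exact hU⟩
  choose f hfa hfu using hex
  let g : Fin rL → {i : Fin r // ¬ a ∉ u i} := fun ℓ => ⟨f ℓ, not_not.mpr (hfa ℓ)⟩
  have hg : Function.Bijective g := by
    constructor
    · intro ℓ ℓ' hll
      have hff : f ℓ = f ℓ' := congrArg Subtype.val hll
      apply huL
      rw [← hfu ℓ, ← hfu ℓ', hff]
    · rintro ⟨i, hi⟩
      have hai : a ∈ u i := not_not.mp hi
      have hmem : (u i).erase a ∈ Set.range uL := by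
        rw [hrL]; exact ⟨u i, ⟨Set.mem_range_self i, hai⟩, rfl⟩
      obtain ⟨ℓ, hℓ⟩ := hmem
      refine ⟨ℓ, Subtype.ext ?_⟩
      apply hu
      have h1 := Finset.insert_erase (hfa ℓ)
      have h2 := Finset.insert_erase hai
      rw [← h1, ← h2, hfu ℓ, hℓ]
  exact ⟨Equiv.ofBijective g hg, fun ℓ => hfu ℓ⟩

variable {K : ℕ}

/-- **THE EQUAL-LINK STEP from ranges.** Let `u` be an injective LOWER family and `w` an injective family on `Fin h`, `a`, `b` coordinates.
Let `uD`, `wD` (size `rD`) enumerate injectively the members of `u` avoiding `a` and of `w` avoiding `b`, and `uL`, `wL` (size `rL`) the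
sets `U ∖ a` (`a ∈ U ∈ u`) and `W ∖ b` (`b ∈ W ∈ w`) — so the two links have EQUAL size. If `(uD, wD)` and `(uL, wL)` have nonsingular
one-cube full hidden sums with `K` states, then `(u, w)` has one with `K + 1` states. -/
theorem fullJoinCube_step_of_ranges (u w : Fin r → Finset (Fin h)) (hu : Function.Injective u) (hw : Function.Injective w)
    (hul : IsLowerSet (Set.range u)) (a b : Fin h)
    (uD wD : Fin rD → Finset (Fin h)) (uL wL : Fin rL → Finset (Fin h))
    (huD : Function.Injective uD) (hwD : Function.Injective wD)
    (huL : Function.Injective uL) (hwL : Function.Injective wL)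
    (hrD : Set.range uD = {U | U ∈ Set.range u ∧ a ∉ U}) (hrD' : Set.range wD = {W | W ∈ Set.range w ∧ b ∉ W})
    (hrL : Set.range uL = (fun U => U.erase a) '' {U | U ∈ Set.range u ∧ a ∈ U})
    (hrL' : Set.range wL = (fun W => W.erase b) '' {W | W ∈ Set.range w ∧ b ∈ W})
    (HD : ∃ (tx ty : Option (Fin K) → Fin h → ℂ) (lam : Fin K → ℂ),
      (Matrix.of fun i j : Fin rD => ∑ J : Finset (Fin K), (∏ q ∈ J, lam q) *
          ((∏ a' ∈ uD i, (tx none a' + ∑ q ∈ J, tx (some q) a')) *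
            ∏ c ∈ wD j, (ty none c + ∑ q ∈ J, ty (some q) c))).det ≠ 0)
    (HL : ∃ (tx ty : Option (Fin K) → Fin h → ℂ) (lam : Fin K → ℂ),
      (Matrix.of fun ℓ ℓ' : Fin rL => ∑ J : Finset (Fin K), (∏ q ∈ J, lam q) *
          ((∏ a' ∈ uL ℓ, (tx none a' + ∑ q ∈ J, tx (some q) a')) *
            ∏ c ∈ wL ℓ', (ty none c + ∑ q ∈ J, ty (some q) c))).det ≠ 0) :
    ∃ (tx' ty' : Option (Fin (K + 1)) → Fin h → ℂ) (lam' : Fin (K + 1) → ℂ),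
      (Matrix.of fun i j : Fin r => ∑ J : Finset (Fin (K + 1)), (∏ q ∈ J, lam' q) *
        ((∏ a' ∈ u i, (tx' none a' + ∑ q ∈ J, tx' (some q) a')) *
          ∏ c ∈ w j, (ty' none c + ∑ q ∈ J, ty' (some q) c))).det ≠ 0 := by
  classical
  obtain ⟨eD, heD⟩ := exists_equiv_deletion u hu a uD huD hrD
  obtain ⟨eL, heL⟩ := exists_equiv_link u hu a uL huL hrL
  obtain ⟨fD, hfD⟩ := exists_equiv_deletion w hw b wD hwD hrD'
  obtain ⟨fL, hfL⟩ := exists_equiv_link w hw b wL hwL hrL'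
  let eRow : Fin rD ⊕ Fin rL ≃ Fin r := (Equiv.sumCongr eD eL).trans (Equiv.sumCompl fun i : Fin r => a ∉ u i)
  let eCol : Fin rD ⊕ Fin rL ≃ Fin r := (Equiv.sumCongr fD fL).trans (Equiv.sumCompl fun j : Fin r => b ∉ w j)
  have hRowl : ∀ i, eRow (Sum.inl i) = (eD i).1 := fun i => rfl
  have hRowr : ∀ ℓ, eRow (Sum.inr ℓ) = (eL ℓ).1 := fun ℓ => rfl
  have hColl : ∀ j, eCol (Sum.inl j) = (fD j).1 := fun j => rfl
  have hColr : ∀ ℓ, eCol (Sum.inr ℓ) = (fL ℓ).1 := fun ℓ => rfl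
  have hDrow : ∀ i, a ∉ u (eRow (Sum.inl i)) := fun i => by rw [hRowl]; exact (eD i).2
  have hLrow : ∀ ℓ, a ∈ u (eRow (Sum.inr ℓ)) := fun ℓ => by rw [hRowr]; exact not_not.mp (eL ℓ).2
  have hDcol : ∀ j, b ∉ w (eCol (Sum.inl j)) := fun j => by rw [hColl]; exact (fD j).2
  have hLcol : ∀ ℓ, b ∈ w (eCol (Sum.inr ℓ)) := fun ℓ => by rw [hColr]; exact not_not.mp (fL ℓ).2
  -- the deletion partner of a link row (lower set!)
  have hπex : ∀ ℓ : Fin rL, ∃ k : Fin rD, uD k = (u (eRow (Sum.inr ℓ))).erase a := by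
    intro ℓ
    have hmem : (u (eRow (Sum.inr ℓ))).erase a ∈ Set.range uD := by
      rw [hrD]
      refine ⟨hul (Finset.erase_subset a _) (Set.mem_range_self _), Finset.notMem_erase a _⟩
    obtain ⟨k, hk⟩ := hmem
    exact ⟨k, hk⟩
  choose π hπ' using hπex
  have hπ : ∀ ℓ, u (eRow (Sum.inl (π ℓ))) = (u (eRow (Sum.inr ℓ))).erase a := by
    intro ℓ; rw [hRowl, heD, hπ' ℓ]
  -- identify the children families with the given enumerations
  have huDeq : (fun i => u (eRow (Sum.inl i))) = uD := funext fun i => by rw [hRowl, heD]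
  have hwDeq : (fun j => w (eCol (Sum.inl j))) = wD := funext fun j => by rw [hColl, hfD]
  have huLeq : (fun ℓ => (u (eRow (Sum.inr ℓ))).erase a) = uL := funext fun ℓ => by rw [hRowr, heL]
  have hwLeq : (fun ℓ => (w (eCol (Sum.inr ℓ))).erase b) = wL := funext fun ℓ => by rw [hColr, hfL]
  refine fullJoinCube_step' u w a b eRow eCol hDrow hLrow hDcol hLcol π hπ ?_ ?_
  · obtain ⟨tx, ty, lam, hdet⟩ := HD
    refine ⟨tx, ty, lam, ?_⟩
    have hmat : (Matrix.of fun i j : Fin rD => ∑ J : Finset (Fin K), (∏ q ∈ J, lam q) *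
          ((∏ a' ∈ u (eRow (Sum.inl i)), (tx none a' + ∑ q ∈ J, tx (some q) a')) *
            ∏ c ∈ w (eCol (Sum.inl j)), (ty none c + ∑ q ∈ J, ty (some q) c))) =
        Matrix.of fun i j : Fin rD => ∑ J : Finset (Fin K), (∏ q ∈ J, lam q) *
          ((∏ a' ∈ uD i, (tx none a' + ∑ q ∈ J, tx (some q) a')) *
            ∏ c ∈ wD j, (ty none c + ∑ q ∈ J, ty (some q) c)) := by
      refine Matrix.ext fun i j => ?_
      rw [Matrix.of_apply, Matrix.of_apply, ← congrFun huDeq i, ← congrFun hwDeq j]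
    rw [hmat]; exact hdet
  · obtain ⟨tx, ty, lam, hdet⟩ := HL
    refine ⟨tx, ty, lam, ?_⟩
    have hmat : (Matrix.of fun ℓ ℓ' : Fin rL => ∑ J : Finset (Fin K), (∏ q ∈ J, lam q) *
          ((∏ a' ∈ (u (eRow (Sum.inr ℓ))).erase a, (tx none a' + ∑ q ∈ J, tx (some q) a')) *
            ∏ c ∈ (w (eCol (Sum.inr ℓ'))).erase b, (ty none c + ∑ q ∈ J, ty (some q) c))) =
        Matrix.of fun ℓ ℓ' : Fin rL => ∑ J : Finset (Fin K), (∏ q ∈ J, lam q) *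
          ((∏ a' ∈ uL ℓ, (tx none a' + ∑ q ∈ J, tx (some q) a')) *
            ∏ c ∈ wL ℓ', (ty none c + ∑ q ∈ J, ty (some q) c)) := by
      refine Matrix.ext fun ℓ ℓ' => ?_
      rw [Matrix.of_apply, Matrix.of_apply, ← congrFun huLeq ℓ, ← congrFun hwLeq ℓ']
    rw [hmat]; exact hdet

end FullJoin

end

end Summit.ValiantsHypothesis.ValiantsHypothesis.Theorems.BarrierLever.HiddenStates
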